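import Summits.ResolutionOfSingularities.ResolutionOfSingularities.Theorems.FrobeniusClosingSteerBetaPolygonWords
import HarnessLib

/-!
# Crux `Steer` (stmt-ResolutionOfSingularities-16345), chain W4.1 — hK4′ β-leaf WORDS, part 2: the GAUGE of `t² = f` (plain and TWISTED
# `f ↦ f + u·q²`), the STAR values, strict thresholds, the δ-face, dissolvability and preparedness at a vertex — VERBATIM res-L0-w41-idea-1 v18

OURS (campaign `res-hironaka`, rung L ★L-G4, slot W4.1; filed by res-L0-w41-stub-1 g4 as K-β1♭ owner, res-L0-w41-plan-1 RULINGS 143 / 147b /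
150 (1)(3) / 157a). VERBATIM copy of §2 (`IsGaugeRep AlphaStarGe DeltaStarGe IsDeltaStar IsVStar` — the plain gauge, kept for the record of
`PrepDebtHat`) and §2♭ (`IsGaugeRepTw isGaugeRepTw_one_iff AlphaStarGeTw DeltaStarGeTw IsDeltaStarTw IsVStarTw BetaGt DeltaFaceGe DeltaFaceGt` — the
TWISTED gauge of record, RULING 150 (1); the four vertex PREDICATES `IsDissolvableTwAt IsFaceDissolvableTwAt IsPreparedTwAt IsFacePreparedTwAt` are
DEFERRED to a part-3 file after res-L0-w41-tri-2's v23 audit, per res-L0-w41-plan-1 RULING 162a) of res-L0-w41-idea-1 g10's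
`L/res-L0-w41-idea-1/Sketch-idea-1-v18-hatleaf.lean` sha16 28348302c226e2cf; only the namespace differs (`…Theorems.SwitchingDichotomy.BetaPolygon`), so
that K-β1♭ (`PrepAttainHat` / `VertexTheoremTwHat` / `PrepDebtHatArith`), K-β2♭ (hat letter laws) and the leaf can be typed Theses-free against
ONE tree copy (§1 = `…BetaPolygonWords` p536143). The gauge of the torsor `t² = u·f` in characteristic 2: cleaning `f ↦ f + u·q²` and
preparation `z ↦ z + φ`, `w ↦ w + ψ`, `φ, ψ ∈ (x, y)`; STAR values are (lexicographic) sups over the orbit; a vertex is DISSOLVABLE when an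
integral translation + cleaning pushes the left vertex (resp. the lower end of the δ-face) lexicographically beyond it (CJS Def. 7.7 / 11.2–11.3,
Lemma 12.1 (4) + cleaning). They replace the role of no printed item and are NOT statements of the manuscript under review [claim: Hironaka2017,
status: under-review]; AI review is weaker than expert review. Definitions only (plus `isGaugeRepTw_one_iff`); no Theses import; nothing here is
a route item or a registration. [cite: CossartJannsenSaito2020, Def. 11.2] [folklore]
-/

-- `Summit.<S>.<S>.…` duplicates the summit name by design (single-problem summit).
set_option linter.dupNamespace false
set_option autoImplicit false

open IsLocalRing

namespace Summit.ResolutionOfSingularities.ResolutionOfSingularities.Theorems.SwitchingDichotomy.BetaPolygon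

/-! ## §2 The gauge of `t² = f` and the STAR values (VERBATIM idea-1 v18 §2) -/

section Gauge
variable {S : Type} [CommRing S]

/-- `(z′, w′, f′)` is a GAUGE REPRESENTATIVE of `(z, w, f)`: preparation `z′ − z, w′ − w ∈ (x, y)` and cleaning `f′ = f + q²`
(char 2: `(t + q)² = f + q²`). OURS. [folklore] -/
def IsGaugeRep (x y z w f z' w' f' : S) : Prop :=
  z' - z ∈ Ideal.span {x, y} ∧ w' - w ∈ Ideal.span {x, y} ∧ ∃ q : S, f' = f + q ^ 2

/-- `α* ≥ ρ`: some gauge representative has `α ≥ ρ`. OURS. [folklore] -/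
def AlphaStarGe (x y z w : S) (d : ℕ) (ρ : ℚ) (f : S) : Prop :=
  ∃ z' w' f' : S, IsGaugeRep x y z w f z' w' f' ∧ AlphaGe x z' w' d ρ f'

/-- `δ* ≥ ρ`. OURS. [folklore] -/
def DeltaStarGe (x y z w : S) (d : ℕ) (ρ : ℚ) (f : S) : Prop :=
  ∃ z' w' f' : S, IsGaugeRep x y z w f z' w' f' ∧ DeltaGe x y z' w' d ρ f'

/-- `δ*(f) = δ` (sup over the gauge orbit, attained). OURS. [folklore] -/
def IsDeltaStar (x y z w : S) (d : ℕ) (δ : ℚ) (f : S) : Prop :=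
  DeltaStarGe x y z w d δ f ∧ ∀ ρ : ℚ, DeltaStarGe x y z w d ρ f → ρ ≤ δ

/-- `v*(f) = (α, β)`: the LEXICOGRAPHIC sup of the left vertex over the gauge orbit, attained by one representative («`v`-prepared modulo
squares»; CJS Def. 11.2–11.3 + cleaning; CP arithm. II Def. 9.4 `(A₁, β)` in dim 3). OURS. [folklore] -/
def IsVStar (x y z w : S) (d : ℕ) (α β : ℚ) (f : S) : Prop :=
  (∃ z' w' f' : S, IsGaugeRep x y z w f z' w' f' ∧ AlphaGe x z' w' d α f' ∧ BetaGe x y z' w' d α β f') ∧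
  (∀ (z' w' f' : S) (ρ : ℚ), IsGaugeRep x y z w f z' w' f' → AlphaGe x z' w' d ρ f' → ρ ≤ α) ∧
  (∀ (z' w' f' : S) (ρ : ℚ), IsGaugeRep x y z w f z' w' f' → AlphaGe x z' w' d α f' → BetaGe x y z' w' d α ρ f' → ρ ≤ β)

end Gauge

/-! ## §2♭ TWISTED gauge and star values; strict thresholds and the δ-face (VERBATIM idea-1 v18 §2♭, stable core per RULING 162a) -/

section GaugeTw
variable {S : Type} [CommRing S]

/-- TWISTED gauge representative: preparation `z′ − z, w′ − w ∈ (x, y)` and cleaning `f′ = f + u·q²`. OURS. [folklore] -/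
def IsGaugeRepTw (u x y z w f z' w' f' : S) : Prop :=
  z' - z ∈ Ideal.span {x, y} ∧ w' - w ∈ Ideal.span {x, y} ∧ ∃ q : S, f' = f + u * q ^ 2

/-- The plain gauge is the twisted gauge with `u = 1`. (Docstring added; statement and proof VERBATIM.) [folklore] -/
theorem isGaugeRepTw_one_iff (x y z w f z' w' f' : S) :
    IsGaugeRepTw 1 x y z w f z' w' f' ↔ IsGaugeRep x y z w f z' w' f' := by
  simp [IsGaugeRepTw, IsGaugeRep]

/-- twisted `α* ≥ ρ`. OURS. [folklore] -/
def AlphaStarGeTw (u x y z w : S) (d : ℕ) (ρ : ℚ) (f : S) : Prop :=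
  ∃ z' w' f' : S, IsGaugeRepTw u x y z w f z' w' f' ∧ AlphaGe x z' w' d ρ f'

/-- twisted `δ* ≥ ρ`. OURS. [folklore] -/
def DeltaStarGeTw (u x y z w : S) (d : ℕ) (ρ : ℚ) (f : S) : Prop :=
  ∃ z' w' f' : S, IsGaugeRepTw u x y z w f z' w' f' ∧ DeltaGe x y z' w' d ρ f'

/-- twisted `δ* = δ`. OURS. [folklore] -/
def IsDeltaStarTw (u x y z w : S) (d : ℕ) (δ : ℚ) (f : S) : Prop :=
  DeltaStarGeTw u x y z w d δ f ∧ ∀ ρ : ℚ, DeltaStarGeTw u x y z w d ρ f → ρ ≤ δ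

/-- twisted `v* = (α, β)`: the lexicographic sup of the left vertex over the TWISTED gauge orbit, attained. OURS. [folklore] -/
def IsVStarTw (u x y z w : S) (d : ℕ) (α β : ℚ) (f : S) : Prop :=
  (∃ z' w' f' : S, IsGaugeRepTw u x y z w f z' w' f' ∧ AlphaGe x z' w' d α f' ∧ BetaGe x y z' w' d α β f') ∧
  (∀ (z' w' f' : S) (ρ : ℚ), IsGaugeRepTw u x y z w f z' w' f' → AlphaGe x z' w' d ρ f' → ρ ≤ α) ∧
  (∀ (z' w' f' : S) (ρ : ℚ), IsGaugeRepTw u x y z w f z' w' f' → AlphaGe x z' w' d α f' → BetaGe x y z' w' d α ρ f' → ρ ≤ β)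

/-! ### Strict thresholds and the δ-face (new words; same monomial-ideal idiom as the tree's `BetaGe`)
Points of `Δ(f ; (z,w) ; (x,y))`: `(a, b)/(d − i − j)` for the monomials `x^a y^b z^i w^j`, `i + j < d`. -/

/-- `BetaGt x y z w d α β f`: «the left vertex is LEXICOGRAPHICALLY BEYOND `(α, β)`»: every point `(a, b)` has `a > α`, or `a ≥ α ∧ b > β`.
(`BetaGe … α β f ∧ ¬ BetaGt … α β f` says: the left vertex is exactly `(α, β)`.) OURS. [folklore] -/
def BetaGt (x y z w : S) (d : ℕ) (α β : ℚ) (f : S) : Prop :=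
  f ∈ Ideal.span {z, w} ^ d ⊔
    ⨆ (i : ℕ) (j : ℕ) (_ : i + j < d),
      (Ideal.span {x ^ (⌊α * ((d - i - j : ℕ) : ℚ)⌋₊ + 1) * z ^ i * w ^ j} ⊔
        Ideal.span {x ^ ⌈α * ((d - i - j : ℕ) : ℚ)⌉₊ * y ^ (⌊β * ((d - i - j : ℕ) : ℚ)⌋₊ + 1) * z ^ i * w ^ j})

/-- `DeltaFaceGe x y z w d δ ρ f` («`γ⁻ ≥ ρ` on the `δ`-face», CJS (7.4) `γ⁻`): every point `(a, b)` has `a + b > δ`, or `a + b = δ ∧ b ≥ ρ`.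
As an ideal: `(x,y)^(⌊δm⌋+1) + y^⌈ρm⌉ · (x,y)^(⌈δm⌉ − ⌈ρm⌉)` in the slot `m = d − i − j` (when `δm ∉ ℕ` or `ρ > δ` the second summand is absorbed
by the first, as it should). OURS. [folklore] -/
def DeltaFaceGe (x y z w : S) (d : ℕ) (δ ρ : ℚ) (f : S) : Prop :=
  f ∈ Ideal.span {z, w} ^ d ⊔
    ⨆ (i : ℕ) (j : ℕ) (_ : i + j < d),
      (Ideal.span {x, y} ^ (⌊δ * ((d - i - j : ℕ) : ℚ)⌋₊ + 1) ⊔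
        Ideal.span {y ^ ⌈ρ * ((d - i - j : ℕ) : ℚ)⌉₊} *
          Ideal.span {x, y} ^ (⌈δ * ((d - i - j : ℕ) : ℚ)⌉₊ - ⌈ρ * ((d - i - j : ℕ) : ℚ)⌉₊)) *
        Ideal.span {z ^ i * w ^ j}

/-- `DeltaFaceGt x y z w d δ β f`: every point has `a + b > δ`, or `a + b = δ ∧ b > β` — i.e. the LOWER END `w⁻ = (δ − β, β)` of the `δ`-face is
NOT a point. (`DeltaGe δ ∧ DeltaFaceGe δ β ∧ ¬ DeltaFaceGt δ β`: `w⁻(f) = (δ − β, β)` exactly.) OURS. [folklore] -/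
def DeltaFaceGt (x y z w : S) (d : ℕ) (δ β : ℚ) (f : S) : Prop :=
  f ∈ Ideal.span {z, w} ^ d ⊔
    ⨆ (i : ℕ) (j : ℕ) (_ : i + j < d),
      (Ideal.span {x, y} ^ (⌊δ * ((d - i - j : ℕ) : ℚ)⌋₊ + 1) ⊔
        Ideal.span {y ^ (⌊β * ((d - i - j : ℕ) : ℚ)⌋₊ + 1)} *
          Ideal.span {x, y} ^ (⌈δ * ((d - i - j : ℕ) : ℚ)⌉₊ - (⌊β * ((d - i - j : ℕ) : ℚ)⌋₊ + 1))) *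
        Ideal.span {z ^ i * w ^ j}

end GaugeTw

end Summit.ResolutionOfSingularities.ResolutionOfSingularities.Theorems.SwitchingDichotomy.BetaPolygon
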